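import Summits.QuantumFields.YangMills.Theorems.BalabanLadderIRColdPurityQuarterDoorSU2
import Summits.Ventures.YMGap.RobustBall.BoundaryDecayBall
import HarnessLib

/-!
# Crux `IR` (stmt-QuantumFields-19354), cold-purity currency: the `SU(N)` COLD-PURITY CORNER THROUGH THE BAKRY–ÉMERY PAIR
# DOOR, EVERY `N ≥ 2` — `δᶜ_β(L) ≤ (L·L·L·2⌊L/4⌋·6) · 64 N⁴√N · max(ρ,½)^{⌊(⌊L/4⌋−3)/2⌋} · β` for tree couplings
# `0 ≤ β < N/48` (`β_W = Nβ < N²/48`)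

Helper file (`--supports stmt-QuantumFields-19354`, helper class; no registered stub claimed) of the pooled IR prover
`ym-ir-line-pool-p3` (g6).  The every-`N` companion of `BalabanLadderIRColdPurityQuarterDoorSU2.lean`: the door is the
tree's HYPOTHESIS-FREE Bakry–Émery one-link pair for `SU(N)`, `N ≥ 2`
(`RobustBall.suN_abs_boundary_sub_integral_le_bakryEmery`: with `b = 6|β|/N < 1/2` and `18(|β|/N)/(1/2 − b) ≤ ρ < 1`,
every finite-volume Wilson distribution with any boundary field is within `2√N · K · #Δ · max(ρ,½)^{⌊D⌋}` of every DLR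
state on Lipschitz cylinders at depth `D`), taken at the Wilson point (`suN_wilson_abs_boundary_sub_integral_le_bakryEmery`),
fed to the generic pair-bound assembly of the `SU(2)` file (`negLogColdRatio_le_of_pairBound`,
`coldDefect_le_negLogColdRatio`) through the local DLR equations of the anisotropic torus read in `ℤ⁴`
(`WilsonFinTorusPeriodicLift`).
* §1 `suN_abs_kernel_plaquetteActionObs_sub_le_bakryEmery` — two exteriors of the window kernel differ on the plaquette
  density `N − Re tr U_p = N − N·(normalised observable)` by `≤ 64 N⁴√N · max(ρ,½)^m` (Lipschitz constant `4N³` of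
  `isLipschitzCylinder_zdPlaquetteObs`, four links, factor `N`, two exteriors through one DLR state);
* §2 `suN_abs_plaquetteActionObs_sub_le_bakryEmery` (two tori) and **`suN_coldDefect_le_of_bakryEmeryDoor`**;
  **`suN_coldDefect_le_of_le_div_84`**: the clean sub-door `84 β ≤ N` (`β_W ≤ N²/84`; ratio `½`):
  `δᶜ_β(L) ≤ (L·L·L·2⌊L/4⌋·6) · 64 N⁴√N · 2^{−⌊(⌊L/4⌋−3)/2⌋} · β`; **`suN_coldExitAt_corner_of_bakryEmeryDoor`** (uniform `L₀`).
READING.  `SU(2)`: `β_W < 1/12` (weaker than the quarter door `2/9` of the `SU(2)` file); `SU(3)`: `β_W < 9/48 ≈ 0.19`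
(×40 over the every-group door `1/216`; crossover `β_W ≈ 5.7`, ≈ 30× above); `SU(N)`: `β_W < N²/48`, the same ≈ 30× below the
`N²`-scaling crossover.  FORMAT rung: strong coupling, width 0 toward `ColdExitAt` / PX.
HONEST FRAMING.  Nothing here proves `BalabanLadder.IR` (0/1), a lattice mass gap, confinement, or the Yang–Mills mass gap
(Clay); R4 closes only the conditional finite-𝕋⁴ rung `BalabanLadder.UV`.
-/

set_option autoImplicit false

noncomputable section

namespace Summit.QuantumFields.YangMills.Cruxes.IR.ColdPurityDobrushin

open MeasureTheory Filter Topology Finset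
open scoped NNReal
open Literature.MathematicalPhysics.QuantumFieldTheory hiding ZdEdge
open Literature.MathematicalPhysics.QuantumLattice
open Summit.QuantumFields.YangMills.Cruxes.IR.ColdPurityBridge (coldDefect)
open Literature.Probability.LatticeModels (Potential)
open Summit.Ventures.YMGap.RobustBall (suN_abs_boundary_sub_integral_le_bakryEmery memBallZd_zero
  perturbedGibbsMeasures_zero perturbedYM_zero MemBallZd)

variable {N : ℕ}
/-! ## §1 The Bakry–Émery door at the Wilson point, and two exteriors of the window kernel -/
section Kernel

/-- **The Bakry–Émery pair door at the WILSON POINT, every `N ≥ 2`, `d = 4`** (zero perturbation, empty support family):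
for tree coupling `β` with `b = 6|β|/N < 1/2` and `18(|β|/N)/(1/2 − b) ≤ ρ < 1`, every DLR state `μ` of `SU(N)` lattice
Yang–Mills on `ℤ⁴` and every finite-volume Wilson distribution with ANY boundary field satisfy
`|∫ F dγ_Λ(·|η) − ∫ F dμ| ≤ 2√N · K · #Δ · max(ρ,½)^{⌊D⌋₊}` on Lipschitz cylinders at depth `D`. -/
theorem suN_wilson_abs_boundary_sub_integral_le_bakryEmery (hN : 2 ≤ N) {β ρ : ℝ}
    (hb : |β| / N * (2 * ((4 : ℝ) - 1)) < 1 / 2)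
    (hρ : 6 * ((4 : ℝ) - 1) * (|β| / N) / (1 / 2 - |β| / N * (2 * ((4 : ℝ) - 1))) ≤ ρ) (hρ1 : ρ < 1)
    {μ : Measure (LGConfig 4 (Matrix.specialUnitaryGroup (Fin N) ℂ))}
    (hμ : μ ∈ ymGibbsMeasures (d := 4) (fundamentalRep (Fin N)) β)
    (Λ : Finset (Literature.MathematicalPhysics.QuantumLattice.ZdEdge 4))
    (η : LGConfig 4 (Matrix.specialUnitaryGroup (Fin N) ℂ))
    {F : LGConfig 4 (Matrix.specialUnitaryGroup (Fin N) ℂ) → ℝ}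
    {Δ : Finset (Literature.MathematicalPhysics.QuantumLattice.ZdEdge 4)} {K : ℝ≥0}
    (hF : IsLipschitzCylinder (fundamentalRep (Fin N)) F Δ K) {D : ℝ}
    (hD : ∀ y ∈ Δ, ∀ z, z ∉ Λ → D ≤ ‖y.1 - z.1‖) :
    |(∫ U, F U ∂(ymSpecification (d := 4) (fundamentalRep (Fin N)) β Λ η)) - ∫ U, F U ∂μ| ≤
      2 * Real.sqrt N * K * Δ.card * (max ρ (1 / 2)) ^ ⌊D⌋₊ := by
  have hN0 : (N : ℝ) ≠ 0 := by exact_mod_cast (show N ≠ 0 by omega)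
  have hβ : (N : ℝ) * (β / N) = β := mul_div_cancel₀ β hN0
  have habs : |β / (N : ℝ)| = |β| / N := by rw [abs_div, Nat.abs_cast]
  have hmem : MemBallZd (N := N) (0 : ℝ) 0 0 (0 : Potential (Literature.MathematicalPhysics.QuantumLattice.ZdEdge 4)
      (Matrix.specialUnitaryGroup (Fin N) ℂ))
      (fun _ => (∅ : Finset (Finset (Literature.MathematicalPhysics.QuantumLattice.ZdEdge 4)))) :=
    memBallZd_zero le_rfl le_rfl fun _ _ h => by simp at h
  have hμ' : μ ∈ Summit.Ventures.YMGap.RobustBall.perturbedGibbsMeasures (d := 4) (fundamentalRep (Fin N))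
      (N * (β / N)) 0 (fun _ => (∅ : Finset (Finset (Literature.MathematicalPhysics.QuantumLattice.ZdEdge 4)))) := by
    rwa [perturbedGibbsMeasures_zero, hβ]
  have key := suN_abs_boundary_sub_integral_le_bakryEmery (d := 4) (by norm_num) hN (β := β / N) (ε₀ := 0) (ε₁ := 0)
    (ρ := ρ) (R := 0) (by rwa [habs]) (by
      rw [habs, Real.exp_zero, zero_div, Real.exp_zero, mul_one, mul_zero, zero_div, add_zero]
      exact hρ) hρ1 hmem hμ' Λ η hF hD
  rw [perturbedYM_zero, hβ, max_eq_left (zero_le_one : (0 : ℝ) ≤ 1), div_one] at key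
  exact key

/-- The `SU(N)` plaquette action density is `N − N ·` the normalised plaquette observable `(1/N) Re tr U_p`. -/
theorem suN_plaquetteActionObs_eq (hN : 2 ≤ N) (p : ZdPlaquette 4)
    (U : LGConfig 4 (Matrix.specialUnitaryGroup (Fin N) ℂ)) :
    plaquetteActionObs (fundamentalRep (Fin N)) p U =
      N - N * zdPlaquetteObs (d := 4) (fundamentalRep (Fin N)) p.1 p.2.1.1 p.2.1.2 U := by
  have hN0 : (N : ℝ) ≠ 0 := by exact_mod_cast (show N ≠ 0 by omega)
  unfold plaquetteActionObs plaquetteObs zdPlaquetteObs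
  rw [← mul_assoc, mul_inv_cancel₀ hN0, one_mul]
  rfl

/-- **Boundary influence on the plaquette density, `SU(N)`, Bakry–Émery door** (`N ≥ 2`; `b = 6|β|/N < 1/2`,
`18(|β|/N)/(1/2 − b) ≤ ρ < 1`): the kernel means of `N − Re tr U_p` over the window of links within sup-distance `m` of the
base point of `p` differ between ANY two exteriors by at most `64 N⁴√N · max(ρ,½)^m`. -/
theorem suN_abs_kernel_plaquetteActionObs_sub_le_bakryEmery (hN : 2 ≤ N) {β ρ : ℝ}
    (hb : |β| / N * (2 * ((4 : ℝ) - 1)) < 1 / 2)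
    (hρ : 6 * ((4 : ℝ) - 1) * (|β| / N) / (1 / 2 - |β| / N * (2 * ((4 : ℝ) - 1))) ≤ ρ) (hρ1 : ρ < 1)
    (p : ZdPlaquette 4) (m : ℕ) {Λ : Finset (Literature.MathematicalPhysics.QuantumLattice.ZdEdge 4)}
    (hΛ : Λ = (Fintype.piFinset fun k => Finset.Icc (p.1 k - m) (p.1 k + m)) ×ˢ (Finset.univ : Finset (Fin 4)))
    (ω η : LGConfig 4 (Matrix.specialUnitaryGroup (Fin N) ℂ)) :
    |(∫ U, plaquetteActionObs (fundamentalRep (Fin N)) p U ∂(ymSpecification (d := 4) (fundamentalRep (Fin N)) β Λ ω)) -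
        ∫ U, plaquetteActionObs (fundamentalRep (Fin N)) p U ∂(ymSpecification (d := 4) (fundamentalRep (Fin N)) β Λ η)| ≤
      64 * (N : ℝ) ^ 4 * Real.sqrt N * (max ρ (1 / 2)) ^ m := by
  classical
  haveI : SecondCountableTopology (Matrix (Fin N) (Fin N) ℂ) :=
    inferInstanceAs (SecondCountableTopology (Fin N → Fin N → ℂ))
  haveI : SecondCountableTopology (Matrix.specialUnitaryGroup (Fin N) ℂ) :=
    Topology.IsEmbedding.subtypeVal.secondCountableTopology
  have hcont : Continuous (fundamentalRep (Fin N)) := continuous_fundamentalRep (Fin N)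
  obtain ⟨μ, hμlim⟩ := infiniteVolumeLimitPoints_nonempty_holds (d := 4) (fundamentalRep (Fin N)) hcont β
  have hμ : μ ∈ ymGibbsMeasures (d := 4) (fundamentalRep (Fin N)) β :=
    mem_ymGibbsMeasures_of_mem_infiniteVolumeLimitPoints_holds (d := 4) (fundamentalRep (Fin N)) hcont hμlim
  have hL := isLipschitzCylinder_zdPlaquetteObs (N := N) (d := 4) p.1 (i := p.2.1.1) (j := p.2.1.2) p.2.2
  have hD : ∀ y ∈ plaquetteEdges ((p.1, ⟨(p.2.1.1, p.2.1.2), p.2.2⟩) : ZdPlaquette 4), ∀ z, z ∉ Λ →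
      (m : ℝ) ≤ ‖y.1 - z.1‖ := fun y hy z hz => le_norm_sub_of_not_mem_window p m hΛ hy hz
  have hb' : ∀ ξ : LGConfig 4 (Matrix.specialUnitaryGroup (Fin N) ℂ),
      |(∫ U, zdPlaquetteObs (d := 4) (fundamentalRep (Fin N)) p.1 p.2.1.1 p.2.1.2 U
          ∂(ymSpecification (d := 4) (fundamentalRep (Fin N)) β Λ ξ)) -
        ∫ U, zdPlaquetteObs (d := 4) (fundamentalRep (Fin N)) p.1 p.2.1.1 p.2.1.2 U ∂μ| ≤
        2 * Real.sqrt N * (4 * (N : ℝ≥0) ^ 3 : ℝ≥0) * 4 * (max ρ (1 / 2)) ^ m := by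
    intro ξ
    have key := suN_wilson_abs_boundary_sub_integral_le_bakryEmery hN hb hρ hρ1 hμ Λ ξ hL hD
    rw [Nat.floor_natCast] at key
    refine key.trans ?_
    have hcard : ((plaquetteEdges ((p.1, ⟨(p.2.1.1, p.2.1.2), p.2.2⟩) : ZdPlaquette 4)).card : ℝ) ≤ 4 := by
      exact_mod_cast card_plaquetteEdges_le _
    have h0 : (0 : ℝ) ≤ 2 * Real.sqrt N * (4 * (N : ℝ≥0) ^ 3 : ℝ≥0) := by positivity
    have hp : (0 : ℝ) ≤ (max ρ (1 / 2)) ^ m := pow_nonneg (le_max_of_le_right (by norm_num)) _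
    calc 2 * Real.sqrt N * ((4 * (N : ℝ≥0) ^ 3 : ℝ≥0) : ℝ) *
          ((plaquetteEdges ((p.1, ⟨(p.2.1.1, p.2.1.2), p.2.2⟩) : ZdPlaquette 4)).card : ℝ) * (max ρ (1 / 2)) ^ m
        = (2 * Real.sqrt N * ((4 * (N : ℝ≥0) ^ 3 : ℝ≥0) : ℝ)) *
            (((plaquetteEdges ((p.1, ⟨(p.2.1.1, p.2.1.2), p.2.2⟩) : ZdPlaquette 4)).card : ℝ) *
              (max ρ (1 / 2)) ^ m) := by ring
      _ ≤ (2 * Real.sqrt N * ((4 * (N : ℝ≥0) ^ 3 : ℝ≥0) : ℝ)) * (4 * (max ρ (1 / 2)) ^ m) :=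
          mul_le_mul_of_nonneg_left (mul_le_mul_of_nonneg_right hcard hp) h0
      _ = 2 * Real.sqrt N * ((4 * (N : ℝ≥0) ^ 3 : ℝ≥0) : ℝ) * 4 * (max ρ (1 / 2)) ^ m := by ring
  -- linearity against the probability kernels
  have hzc : Continuous (zdPlaquetteObs (d := 4) (fundamentalRep (Fin N)) p.1 p.2.1.1 p.2.1.2 :
      LGConfig 4 (Matrix.specialUnitaryGroup (Fin N) ℂ) → ℝ) := by
    have h := continuous_plaquetteObs (fundamentalRep (Fin N)) hcont p.1 p.2.1.1 p.2.1.2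
      (G := Matrix.specialUnitaryGroup (Fin N) ℂ) (d := 4)
    have hN0 : (N : ℝ) ≠ 0 := by exact_mod_cast (show N ≠ 0 by omega)
    have h2 : (zdPlaquetteObs (d := 4) (fundamentalRep (Fin N)) p.1 p.2.1.1 p.2.1.2 :
        LGConfig 4 (Matrix.specialUnitaryGroup (Fin N) ℂ) → ℝ) =
        fun U => (N : ℝ)⁻¹ * plaquetteObs (fundamentalRep (Fin N)) p.1 p.2.1.1 p.2.1.2 U := by
      funext U
      rfl
    rw [h2]
    exact continuous_const.mul h
  have hzb : ∀ U : LGConfig 4 (Matrix.specialUnitaryGroup (Fin N) ℂ),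
      |zdPlaquetteObs (d := 4) (fundamentalRep (Fin N)) p.1 p.2.1.1 p.2.1.2 U| ≤ 1 := fun U =>
    abs_zdPlaquetteObs_le (fun g => fundamentalRep_mem_unitaryGroup g) _ _ _ U
  have hlin : ∀ ξ : LGConfig 4 (Matrix.specialUnitaryGroup (Fin N) ℂ),
      ∫ U, plaquetteActionObs (fundamentalRep (Fin N)) p U ∂(ymSpecification (d := 4) (fundamentalRep (Fin N)) β Λ ξ) =
        N - N * ∫ U, zdPlaquetteObs (d := 4) (fundamentalRep (Fin N)) p.1 p.2.1.1 p.2.1.2 U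
          ∂(ymSpecification (d := 4) (fundamentalRep (Fin N)) β Λ ξ) := by
    intro ξ
    haveI := isProbabilityMeasure_ymSpecification (d := 4) (fundamentalRep (Fin N)) hcont β Λ ξ
    simp only [suN_plaquetteActionObs_eq hN]
    rw [integral_sub (integrable_const _) ((integrable_of_bound hzc.aestronglyMeasurable hzb).const_mul _),
      integral_const, integral_const_mul]
    simp
  rw [hlin ω, hlin η]
  have e : (N : ℝ) - N * (∫ U, zdPlaquetteObs (d := 4) (fundamentalRep (Fin N)) p.1 p.2.1.1 p.2.1.2 U
        ∂(ymSpecification (d := 4) (fundamentalRep (Fin N)) β Λ ω)) -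
      (N - N * ∫ U, zdPlaquetteObs (d := 4) (fundamentalRep (Fin N)) p.1 p.2.1.1 p.2.1.2 U
        ∂(ymSpecification (d := 4) (fundamentalRep (Fin N)) β Λ η)) =
      -N * (((∫ U, zdPlaquetteObs (d := 4) (fundamentalRep (Fin N)) p.1 p.2.1.1 p.2.1.2 U
          ∂(ymSpecification (d := 4) (fundamentalRep (Fin N)) β Λ ω)) -
          ∫ U, zdPlaquetteObs (d := 4) (fundamentalRep (Fin N)) p.1 p.2.1.1 p.2.1.2 U ∂μ) -
        ((∫ U, zdPlaquetteObs (d := 4) (fundamentalRep (Fin N)) p.1 p.2.1.1 p.2.1.2 U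
          ∂(ymSpecification (d := 4) (fundamentalRep (Fin N)) β Λ η)) -
          ∫ U, zdPlaquetteObs (d := 4) (fundamentalRep (Fin N)) p.1 p.2.1.1 p.2.1.2 U ∂μ)) := by ring
  rw [e, abs_mul, abs_neg, Nat.abs_cast]
  have h2 := (abs_sub _ _).trans (add_le_add (hb' ω) (hb' η))
  have hconst : ((4 * (N : ℝ≥0) ^ 3 : ℝ≥0) : ℝ) = 4 * (N : ℝ) ^ 3 := by push_cast; ring
  rw [hconst] at h2
  have hNn : (0 : ℝ) ≤ N := Nat.cast_nonneg _
  have hfinal : (N : ℝ) * (2 * (2 * Real.sqrt N * (4 * (N : ℝ) ^ 3) * 4 * (max ρ (1 / 2)) ^ m)) =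
      64 * (N : ℝ) ^ 4 * Real.sqrt N * (max ρ (1 / 2)) ^ m := by ring
  calc (N : ℝ) * |((∫ U, zdPlaquetteObs (d := 4) (fundamentalRep (Fin N)) p.1 p.2.1.1 p.2.1.2 U
          ∂(ymSpecification (d := 4) (fundamentalRep (Fin N)) β Λ ω)) -
          ∫ U, zdPlaquetteObs (d := 4) (fundamentalRep (Fin N)) p.1 p.2.1.1 p.2.1.2 U ∂μ) -
        ((∫ U, zdPlaquetteObs (d := 4) (fundamentalRep (Fin N)) p.1 p.2.1.1 p.2.1.2 U
          ∂(ymSpecification (d := 4) (fundamentalRep (Fin N)) β Λ η)) -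
          ∫ U, zdPlaquetteObs (d := 4) (fundamentalRep (Fin N)) p.1 p.2.1.1 p.2.1.2 U ∂μ)|
      ≤ (N : ℝ) * (2 * (2 * Real.sqrt N * (4 * (N : ℝ) ^ 3) * 4 * (max ρ (1 / 2)) ^ m)) :=
        mul_le_mul_of_nonneg_left (h2.trans (by linarith)) hNn
    _ = 64 * (N : ℝ) ^ 4 * Real.sqrt N * (max ρ (1 / 2)) ^ m := hfinal
end Kernel
/-! ## §2 Two tori, and the `SU(N)` corner -/
section Corner

/-- **One-point torus-size difference, `SU(N)`, Bakry–Émery door** (`N ≥ 2`; door as in §1; `2m + 2 < L, T₁, T₂`). -/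
theorem suN_abs_plaquetteActionObs_sub_le_bakryEmery (hN : 2 ≤ N) {β ρ : ℝ}
    (hb : |β| / N * (2 * ((4 : ℝ) - 1)) < 1 / 2)
    (hρ : 6 * ((4 : ℝ) - 1) * (|β| / N) / (1 / 2 - |β| / N * (2 * ((4 : ℝ) - 1))) ≤ ρ) (hρ1 : ρ < 1)
    {L T₁ T₂ : ℕ} [NeZero L] [NeZero T₁] [NeZero T₂] {m : ℕ} (hL : 2 * m + 2 < L) (hT₁ : 2 * m + 2 < T₁)
    (hT₂ : 2 * m + 2 < T₂) (p : ZdPlaquette 4) :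
    |finTorusExpectation (fundamentalRep (Fin N)) β
          (fun V : FinTorusSite L L L T₁ × Fin 4 → Matrix.specialUnitaryGroup (Fin N) ℂ =>
            plaquetteActionObs (fundamentalRep (Fin N)) p (finTorusLift L T₁ V)) -
        finTorusExpectation (fundamentalRep (Fin N)) β
          (fun V : FinTorusSite L L L T₂ × Fin 4 → Matrix.specialUnitaryGroup (Fin N) ℂ =>
            plaquetteActionObs (fundamentalRep (Fin N)) p (finTorusLift L T₂ V))| ≤
      64 * (N : ℝ) ^ 4 * Real.sqrt N * (max ρ (1 / 2)) ^ m := by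
  haveI : SecondCountableTopology (Matrix (Fin N) (Fin N) ℂ) :=
    inferInstanceAs (SecondCountableTopology (Fin N → Fin N → ℂ))
  haveI : SecondCountableTopology (Matrix.specialUnitaryGroup (Fin N) ℂ) :=
    Topology.IsEmbedding.subtypeVal.secondCountableTopology
  have hcont : Continuous (fundamentalRep (Fin N)) := continuous_fundamentalRep (Fin N)
  obtain ⟨Λ, hΛ⟩ : ∃ Λ : Finset (Literature.MathematicalPhysics.QuantumLattice.ZdEdge 4),
      Λ = (Fintype.piFinset fun k => Finset.Icc (p.1 k - m) (p.1 k + m)) ×ˢ (Finset.univ : Finset (Fin 4)) :=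
    ⟨_, rfl⟩
  exact abs_finTorusExpectation_lift_sub_lift_le (fundamentalRep (Fin N)) hcont β Λ
    (continuous_plaquetteActionObs (fundamentalRep (Fin N)) hcont p)
    (abs_plaquetteActionObs_le (fundamentalRep (Fin N)) (fun g => fundamentalRep_mem_unitaryGroup g) p)
    (isCylinder_plaquetteActionObs (fundamentalRep (Fin N)) p) (injOn_windowClosure p.1 m p.2 hΛ hL hT₁)
    (injOn_windowClosure p.1 m p.2 hΛ hL hT₂)
    (suN_abs_kernel_plaquetteActionObs_sub_le_bakryEmery hN hb hρ hρ1 p m hΛ)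

/-- **`SU(N)` COLD-PURITY CORNER THROUGH THE BAKRY–ÉMERY DOOR, every `N ≥ 2`.**  For the fundamental representation of
`SU(N)`, every tree coupling `0 ≤ β` with `b = 6β/N < 1/2` and `18(β/N)/(1/2 − b) ≤ ρ < 1` (`β_W = Nβ < N²/48`) and every
`L ≥ 20`: `δᶜ_β(L) ≤ (L·L·L·2⌊L/4⌋·6) · (64 N⁴√N · max(ρ,½)^{⌊(⌊L/4⌋−3)/2⌋}) · β`.  (FORMAT rung, strong coupling.) -/
theorem suN_coldDefect_le_of_bakryEmeryDoor (hN : 2 ≤ N) {β ρ : ℝ} (h0 : 0 ≤ β)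
    (hb : β / N * (2 * ((4 : ℝ) - 1)) < 1 / 2)
    (hρ : 6 * ((4 : ℝ) - 1) * (β / N) / (1 / 2 - β / N * (2 * ((4 : ℝ) - 1))) ≤ ρ) (hρ1 : ρ < 1)
    {L : ℕ} (hL : 20 ≤ L) :
    coldDefect (fundamentalLatticeRep N).ρ β L ≤
      ((L * L * L * (2 * (L / 4)) : ℕ) : ℝ) * 6 *
        (64 * (N : ℝ) ^ 4 * Real.sqrt N * (max ρ (1 / 2)) ^ (((L / 4) - 3) / 2)) * β := by
  haveI : NeZero L := ⟨by omega⟩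
  haveI : NeZero (L / 4) := ⟨by omega⟩
  haveI : NeZero (2 * (L / 4)) := ⟨by omega⟩
  have hk1 : 2 * ((L / 4 - 3) / 2) + 2 < L := by omega
  have hk2 : 2 * ((L / 4 - 3) / 2) + 2 < L / 4 := by omega
  have hk3 : 2 * ((L / 4 - 3) / 2) + 2 < 2 * (L / 4) := by omega
  have hNpos : (0 : ℝ) < N := by exact_mod_cast (show 0 < N by omega)
  refine (coldDefect_le_negLogColdRatio (fundamentalLatticeRep N) β L).trans ?_
  refine negLogColdRatio_le_of_pairBound (fundamentalLatticeRep N) h0 (t := L / 4) fun b hb' x q => ?_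
  -- the door at `b ∈ [0, β]` (monotone in `|b| ≤ β`)
  have hbabs : |b| = b := abs_of_nonneg hb'.1
  have hle : |b| / N ≤ β / N := by rw [hbabs]; exact div_le_div_of_nonneg_right hb'.2 hNpos.le
  have hbb : |b| / N * (2 * ((4 : ℝ) - 1)) < 1 / 2 := lt_of_le_of_lt (by nlinarith) hb
  have hρb : 6 * ((4 : ℝ) - 1) * (|b| / N) / (1 / 2 - |b| / N * (2 * ((4 : ℝ) - 1))) ≤ ρ := by
    refine le_trans ?_ hρ
    have hden : 0 < 1 / 2 - β / N * (2 * ((4 : ℝ) - 1)) := by linarith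
    have hden' : 0 < 1 / 2 - |b| / N * (2 * ((4 : ℝ) - 1)) := by linarith
    rw [div_le_div_iff₀ hden' hden]
    have h6 : (0 : ℝ) ≤ |b| / N := div_nonneg (abs_nonneg _) hNpos.le
    nlinarith
  have h := suN_abs_plaquetteActionObs_sub_le_bakryEmery hN hbb hρb hρ1 (T₁ := 2 * (L / 4)) (T₂ := L / 4)
    hk1 hk3 hk2 ((finTorusRepr x, q) : ZdPlaquette 4)
  simp only [plaquetteActionObs_finTorusLift, finTorusProjSite_finTorusRepr] at h
  exact h

/-- **The clean sub-door `84 β ≤ N`** (`β_W = Nβ ≤ N²/84`; ratio `½`): `δᶜ_β(L) ≤ (L·L·L·2⌊L/4⌋·6)·64 N⁴√N·2^{−⌊(⌊L/4⌋−3)/2⌋}·β`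
for every `L ≥ 20` (`b = 6β/N ≤ 1/14`, `18(β/N)/(1/2 − b) ≤ (3/14)/(3/7) = 1/2`). -/
theorem suN_coldDefect_le_of_le_div_84 (hN : 2 ≤ N) {β : ℝ} (h0 : 0 ≤ β) (hβ : 84 * β ≤ N) {L : ℕ} (hL : 20 ≤ L) :
    coldDefect (fundamentalLatticeRep N).ρ β L ≤
      ((L * L * L * (2 * (L / 4)) : ℕ) : ℝ) * 6 *
        (64 * (N : ℝ) ^ 4 * Real.sqrt N * (1 / 2 : ℝ) ^ (((L / 4) - 3) / 2)) * β := by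
  have hNpos : (0 : ℝ) < N := by exact_mod_cast (show 0 < N by omega)
  have hq : β / N ≤ 1 / 84 := by rw [div_le_iff₀ hNpos]; linarith
  have hq0 : 0 ≤ β / N := div_nonneg h0 hNpos.le
  have hb : β / N * (2 * ((4 : ℝ) - 1)) < 1 / 2 := by nlinarith
  have hρ : 6 * ((4 : ℝ) - 1) * (β / N) / (1 / 2 - β / N * (2 * ((4 : ℝ) - 1))) ≤ 1 / 2 := by
    have hden : 0 < 1 / 2 - β / N * (2 * ((4 : ℝ) - 1)) := by linarith
    rw [div_le_iff₀ hden]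
    nlinarith
  have h := suN_coldDefect_le_of_bakryEmeryDoor hN h0 hb hρ (by norm_num) hL
  rwa [max_self] at h

/-- **UNIFORM `SU(N)` CORNER THROUGH THE BAKRY–ÉMERY DOOR**: for every `N ≥ 2` and `θ > 0` there is an explicit `L₀` such
that `δᶜ_β(L) ≤ θ` for every tree coupling `0 ≤ β ≤ N/84` (`β_W ≤ N²/84`) and every `L ≥ L₀`.  (FORMAT rung; opposite corner
to `ColdExitAt`.) -/
theorem suN_coldExitAt_corner_of_bakryEmeryDoor (hN : 2 ≤ N) {θ : ℝ} (hθ : 0 < θ) :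
    ∃ L₀ : ℕ, ∀ β : ℝ, 0 ≤ β → 84 * β ≤ N → ∀ L : ℕ, L₀ ≤ L → coldDefect (fundamentalLatticeRep N).ρ β L ≤ θ := by
  have hNpos : (0 : ℝ) < N := by exact_mod_cast (show 0 < N by omega)
  obtain ⟨L₀, hL₀⟩ := eventually_volume_mul_pow_le (c := 1 / 2)
    (A := 6 * (64 * (N : ℝ) ^ 4 * Real.sqrt N) * (N / 84)) (by norm_num) (by norm_num) (by positivity) hθ
  refine ⟨max L₀ 20, fun β h0 hβ L hL => ?_⟩
  have hmain := suN_coldDefect_le_of_le_div_84 hN h0 hβ (le_trans (le_max_right _ _) hL)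
  refine hmain.trans (le_trans ?_ (hL₀ L (le_trans (le_max_left _ _) hL)))
  have hβ' : β ≤ N / 84 := by rw [le_div_iff₀ (by norm_num : (0:ℝ) < 84)]; linarith
  have hV : (0 : ℝ) ≤ ((L * L * L * (2 * (L / 4)) : ℕ) : ℝ) := Nat.cast_nonneg _
  have hP : (0 : ℝ) ≤ (1 / 2 : ℝ) ^ (((L / 4) - 3) / 2) := by positivity
  have e : ((L * L * L * (2 * (L / 4)) : ℕ) : ℝ) * 6 *
        (64 * (N : ℝ) ^ 4 * Real.sqrt N * (1 / 2 : ℝ) ^ (((L / 4) - 3) / 2)) * β =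
      (6 * (64 * (N : ℝ) ^ 4 * Real.sqrt N) * β) * ((L * L * L * (2 * (L / 4)) : ℕ) : ℝ) *
        (1 / 2 : ℝ) ^ (((L / 4) - 3) / 2) := by ring
  rw [e]
  have hcoef : 6 * (64 * (N : ℝ) ^ 4 * Real.sqrt N) * β ≤ 6 * (64 * (N : ℝ) ^ 4 * Real.sqrt N) * (N / 84) :=
    mul_le_mul_of_nonneg_left hβ' (by positivity)
  exact mul_le_mul_of_nonneg_right (mul_le_mul_of_nonneg_right hcoef hV) hP
end Corner

end Summit.QuantumFields.YangMills.Cruxes.IR.ColdPurityDobrushin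

end
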